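import Summits.NavierStokesRegularity.NavierStokesRegularity.Theses.QuantisedSymmetry
import Summits.NavierStokesRegularity.NavierStokesRegularity.Theses.Blowup
import Summits.NavierStokesRegularity.NavierStokesRegularity.Theses.DssFarFieldSlaving
import Summits.NavierStokesRegularity.NavierStokesRegularity.Theorems.QuantisedSymmetryPolyhedralTruncationBridge
import Summits.NavierStokesRegularity.NavierStokesRegularity.Theorems.QuantisedSymmetryPolyhedralDssProfileExistsDominatesBlowupProfile
import Summits.NavierStokesRegularity.NavierStokesRegularity.Theorems.QuantisedSymmetryPolyhedralDssProfileExistsCellOfProfile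
import Summits.NavierStokesRegularity.NavierStokesRegularity.Theorems.QuantisedSymmetryLiouvilleKillsProfile
import Summits.NavierStokesRegularity.NavierStokesRegularity.Theorems.DssFarFieldSlavingDssTruncationBridge
import Summits.NavierStokesRegularity.NavierStokesRegularity.Theorems.DssFarFieldSlavingBlowupTypeIDssProfileGaussianSmallTypeI
import Literature.Analysis.FluidPDE.SelfSimilar
import Literature.Analysis.FluidPDE.SelfSimilarLiouville
import Literature.Barriers.NavierStokesRegularity.NearOneDssTypeIExclusion
import HarnessLib

set_option linter.dupNamespace false

/-!
# Strategist census s14 (family `-s`, independent) — typed companion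

Crux `PolyhedralDssProfileExists` (stmt-NavierStokesRegularity-1404) of route `QuantisedSymmetry`.
This file is the kernel-checked part of `STRATEGY-CENSUS-s14.md`; it proves nothing new about
Navier–Stokes.  It records, over tree declarations only:

* `F1` the crux ALONE decides the summit negatively (`crux_implies_not_summit`), i.e. the crux is a
  strengthening of the route's own target `¬ NavierStokesRegularity`;
* `F2` the only strictly weaker intermediates between the crux and `¬S` that the tree can certify
  (`W1 = Blowup.BlowupTypeIDssProfile`, stmt-0155, sector-free; `W2 = ¬ PolyhedralTypeILiouville`,
  which is weaker than the crux but is NOT known to imply `¬S`);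
* `D1` the best typed split found (certificate ∧ shadowing, the computer-assisted-proof shape), with
  its assembly proved — recorded, NOT registered (census §Decomposition says why);
* `N` the certified negative-side rungs the tree already gives inside the polyhedral sector
  (small Type-I constant; fine ratio is cited by name from the barrier file).
-/

namespace Summit.NavierStokesRegularity.NavierStokesRegularity.Cruxes.PolyhedralDssProfileExists.StrategistS14

open MeasureTheory
open Literature.Analysis.FluidPDE

/-! ## F1 — the crux decides the summit (negatively), by tree theorems only -/

/-- `X ⇒ ¬S`: the crux together with the two CLOSED items of the route (`PolyhedralTruncationBridge`,
stmt-11331, proved; `ClayUniqueness`, stmt-0153, proved) refutes Clay (A).  Hence any replacement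
`W` with `X ⇒ W ⇒ ¬S` is itself a blow-up-existence statement. [folklore; tree composition] -/
theorem crux_implies_not_summit
    (hX : _root_.Summit.NavierStokesRegularity.NavierStokesRegularity.Theses.QuantisedSymmetry.PolyhedralDssProfileExists) :
    ¬ _root_.NavierStokesRegularity :=
  _root_.Summit.NavierStokesRegularity.NavierStokesRegularity.Theses.QuantisedSymmetry.closes hX
    _root_.Summit.NavierStokesRegularity.NavierStokesRegularity.Theorems.quantisedSymmetry_polyhedralTruncationBridge_proof
    _root_.Summit.NavierStokesRegularity.NavierStokesRegularity.Theses.QuantisedSymmetry.ClayUniqueness_holds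

/-! ## F2 — weaker intermediates -/

/-- `W1`: the sector-free weakening "Tsai's Type-I (rotated) λ-DSS Liouville statement fails for some
λ" (= `Blowup.BlowupTypeIDssProfile`, stmt-0155).  `X ⇒ W1` is the registered stub
`stub_dominatesBlowupProfile` of line `polyhedral_cell`. [tree] -/
theorem crux_implies_W1
    (hX : _root_.Summit.NavierStokesRegularity.NavierStokesRegularity.Theses.QuantisedSymmetry.PolyhedralDssProfileExists) :
    _root_.Summit.NavierStokesRegularity.NavierStokesRegularity.Theses.Blowup.BlowupTypeIDssProfile :=
  _root_.Summit.NavierStokesRegularity.NavierStokesRegularity.Theorems.PolyhedralDssProfileExists.PolyhedralCell.stub_dominatesBlowupProfile hX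

/-- `W1 ⇒ ¬S` is ALSO tree-certified (route `DssFarFieldSlaving`: `closes` + the proved
`dssTruncationBridge_proof`, stmt-14477).  So `W1` could replace `X` in a deciding theorem — but `W1`
is the open deciding crux of other routes (stmt-0155), carries no mechanism of its own, and
replacing `X` by it deletes this route's only content (the polyhedral sector). [tree] -/
theorem W1_implies_not_summit
    (hW : _root_.Summit.NavierStokesRegularity.NavierStokesRegularity.Theses.Blowup.BlowupTypeIDssProfile) :
    ¬ _root_.NavierStokesRegularity :=
  _root_.Summit.NavierStokesRegularity.NavierStokesRegularity.Theses.DssFarFieldSlaving.closes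
    _root_.Summit.NavierStokesRegularity.NavierStokesRegularity.Theorems.dssTruncationBridge_proof hW

/-- `W2 := ¬ PolyhedralTypeILiouville` (negation of the route's kill switch, stmt-1405).  `X ⇒ W2` is
the proved support item `LiouvilleKillsProfile` (stmt-1408).  `W2 ⇒ ¬S` is NOT a theorem of the tree
(a bounded polyhedral Type-I ancient solution need not be DSS, and no truncation bridge starts from
it), so `W2` cannot replace `X` in `closes`. [tree] -/
theorem crux_implies_W2
    (hX : _root_.Summit.NavierStokesRegularity.NavierStokesRegularity.Theses.QuantisedSymmetry.PolyhedralDssProfileExists) :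
    ¬ _root_.Summit.NavierStokesRegularity.NavierStokesRegularity.Theses.QuantisedSymmetry.PolyhedralTypeILiouville :=
  fun hL =>
    _root_.Summit.NavierStokesRegularity.NavierStokesRegularity.Theorems.quantisedSymmetry_liouvilleKillsProfile_proof
      hL hX

/-! ## D1 — the certificate ∧ shadowing split (typed shape; assembly proved; NOT registered) -/

/-- One fibre `(G, λ)` of the live line's cell statement: a `G`-equivariant Oseen-mild cell on the
slab `[-1, -λ⁻²]` with the DSS junction and a nontrivial `L⁴` datum (verbatim the right-hand side of
`profile_iff_cell_fibre`). [tree] -/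
def CellExistsFibre (G : Subgroup (EuclideanSpace ℝ (Fin 3) ≃ₗᵢ[ℝ] EuclideanSpace ℝ (Fin 3)))
    (c : ℝ) : Prop :=
  ∃ v : ℝ → EuclideanSpace ℝ (Fin 3) → EuclideanSpace ℝ (Fin 3),
    (ContinuousOn (Function.uncurry v) (Set.Icc (-1 : ℝ) (-(c ^ 2)⁻¹) ×ˢ Set.univ) ∧
      (∃ M : ℝ, ∀ t ∈ Set.Icc (-1 : ℝ) (-(c ^ 2)⁻¹), ∀ x, ‖v t x‖ ≤ M) ∧
      (∀ t ∈ Set.Icc (-1 : ℝ) (-(c ^ 2)⁻¹), IsWeaklyDivFree (v t)) ∧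
      (∀ s t : ℝ, -1 ≤ s → s < t → t ≤ -(c ^ 2)⁻¹ → ∀ x,
        v t x = heatFlow (v s) (t - s) x - oseenDuhamel 1 s v v t x) ∧
      (∀ x, v (-(c ^ 2)⁻¹) x = c • v (-1) (c • x)) ∧
      (∀ g ∈ G, ∀ t ∈ Set.Icc (-1 : ℝ) (-(c ^ 2)⁻¹), ∀ x, v t (g x) = g (v t x))) ∧
    MemLp (v (-1)) 4 volume ∧ ¬ (v (-1) =ᵐ[volume] 0)

/-- The copy is verbatim: the fibrewise profile ↔ cell equivalence of the tree applies to it. [tree] -/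
theorem profileFibre_iff_cellExistsFibre
    (G : Subgroup (EuclideanSpace ℝ (Fin 3) ≃ₗᵢ[ℝ] EuclideanSpace ℝ (Fin 3))) {c : ℝ} (hc : 1 < c) :
    (∃ u : ℝ → EuclideanSpace ℝ (Fin 3) → EuclideanSpace ℝ (Fin 3),
        IsAncientMildSolution 1 u ∧ (∀ t < 0, AEStronglyMeasurable (u t) volume) ∧
        IsDiscretelySelfSimilar c u ∧ (∃ C₀ : ℝ, HasTypeIDecay C₀ u) ∧
        (∀ g ∈ G, ∀ t x, u t (g x) = g (u t x)) ∧ ¬ (∀ t < 0, u t =ᵐ[volume] 0)) ↔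
      CellExistsFibre G c :=
  _root_.Summit.NavierStokesRegularity.NavierStokesRegularity.Theorems.PolyhedralDssProfileExists.PolyhedralCell.profile_iff_cell_fibre
    G hc

/-- An **`ε`-approximate `G`-cell of size `≥ δ`**: the cell conditions with the Oseen-mild identity
relaxed to a uniform residual `≤ ε`, plus a pointwise size floor `δ` at the initial slice (needed:
without a floor, `v ≈ 0` is an approximate cell and shadowing would contradict the small-constant
Liouville theorem). [this census] -/
def IsApproxCell (ε δ : ℝ)
    (G : Subgroup (EuclideanSpace ℝ (Fin 3) ≃ₗᵢ[ℝ] EuclideanSpace ℝ (Fin 3))) (c : ℝ)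
    (v : ℝ → EuclideanSpace ℝ (Fin 3) → EuclideanSpace ℝ (Fin 3)) : Prop :=
  ContinuousOn (Function.uncurry v) (Set.Icc (-1 : ℝ) (-(c ^ 2)⁻¹) ×ˢ Set.univ) ∧
    (∃ M : ℝ, ∀ t ∈ Set.Icc (-1 : ℝ) (-(c ^ 2)⁻¹), ∀ x, ‖v t x‖ ≤ M) ∧
    (∀ t ∈ Set.Icc (-1 : ℝ) (-(c ^ 2)⁻¹), IsWeaklyDivFree (v t)) ∧
    (∀ s t : ℝ, -1 ≤ s → s < t → t ≤ -(c ^ 2)⁻¹ → ∀ x,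
      ‖v t x - (heatFlow (v s) (t - s) x - oseenDuhamel 1 s v v t x)‖ ≤ ε) ∧
    (∀ x, v (-(c ^ 2)⁻¹) x = c • v (-1) (c • x)) ∧
    (∀ g ∈ G, ∀ t ∈ Set.Icc (-1 : ℝ) (-(c ^ 2)⁻¹), ∀ x, v t (g x) = g (v t x)) ∧
    ∃ x, δ ≤ ‖v (-1) x‖

/-- **D1 piece A (certificate).** Some polyhedral `ε`-approximate cell of size `≥ δ` exists — the
object a validated numerical computation would deliver. [this census] -/
def CertificatePiece (ε δ : ℝ) : Prop :=
  ∃ G : Subgroup (EuclideanSpace ℝ (Fin 3) ≃ₗᵢ[ℝ] EuclideanSpace ℝ (Fin 3)), Finite G ∧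
    (∀ g ∈ G, LinearMap.det (g.toLinearEquiv :
        EuclideanSpace ℝ (Fin 3) →ₗ[ℝ] EuclideanSpace ℝ (Fin 3)) = 1) ∧
    (∀ V : Submodule ℝ (EuclideanSpace ℝ (Fin 3)), (∀ g ∈ G, ∀ v ∈ V, g v ∈ V) → V = ⊥ ∨ V = ⊤) ∧
    ∃ c : ℝ, 1 < c ∧ ∃ v, IsApproxCell ε δ G c v

/-- **D1 piece B (shadowing), HONEST SHAPE ONLY.** Every polyhedral `ε`-approximate cell of size
`≥ δ` is shadowed by an exact cell in the same fibre `(G, λ)`.  The statement a Newton–Kantorovich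
argument would actually prove carries, in addition, an explicit bound on the inverse of the
LINEARISED period map at the approximate cell (nondegeneracy) — not expressible over the current
vocabulary (no period-map / Fréchet-derivative declarations for the backward Leray system); as typed
here the piece is therefore stronger than what CAP gives and may well be false. [this census] -/
def ShadowingPiece (ε δ : ℝ) : Prop :=
  ∀ G : Subgroup (EuclideanSpace ℝ (Fin 3) ≃ₗᵢ[ℝ] EuclideanSpace ℝ (Fin 3)), Finite G →
    (∀ g ∈ G, LinearMap.det (g.toLinearEquiv :
        EuclideanSpace ℝ (Fin 3) →ₗ[ℝ] EuclideanSpace ℝ (Fin 3)) = 1) →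
    (∀ V : Submodule ℝ (EuclideanSpace ℝ (Fin 3)), (∀ g ∈ G, ∀ v ∈ V, g v ∈ V) → V = ⊥ ∨ V = ⊤) →
    ∀ c : ℝ, 1 < c → ∀ v, IsApproxCell ε δ G c v → CellExistsFibre G c

/-- **D1 assembly (proved):** certificate ∧ shadowing ⇒ the crux, through the tree's cell ⇒ profile
direction.  Passes (a)–(c) of the redirect test (two pieces, neither gives `X` alone: A is an
approximate object, B is vacuous without A) and FAILS (d): no numerical candidate exists for A and no
enclosure technology for B (census §Decomposition). [this census; tree composition] -/
theorem crux_of_certificate_and_shadowing {ε δ : ℝ}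
    (hA : CertificatePiece ε δ) (hB : ShadowingPiece ε δ) :
    _root_.Summit.NavierStokesRegularity.NavierStokesRegularity.Theses.QuantisedSymmetry.PolyhedralDssProfileExists := by
  obtain ⟨G, hfin, hdet, hirr, c, hc, v, hv⟩ := hA
  have hcell : CellExistsFibre G c := hB G hfin hdet hirr c hc v hv
  obtain ⟨u, hanc, hmeas, hdss, hdec, heqv, hnt⟩ := (profileFibre_iff_cellExistsFibre G hc).mpr hcell
  exact ⟨G, hfin, hdet, hirr, c, hc, u, hanc, hmeas, hdss, hdec, heqv, hnt⟩

/-! ## S — strengthenings (fibre form) -/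

/-- The fibre of the crux over a fixed group `G` and factor `λ`.  Every admissible `G` is conjugate in
`SO(3)` to the rotation group of the tetrahedron, octahedron or icosahedron, and `T ≤ O`, `T ≤ I`, so
(by rotation invariance of Navier–Stokes) the crux is equivalent to its fibre family over one copy of
`T` — a restatement (`k = 1`), useful only as a WLOG for hunters. [this census] -/
def CruxFibre (G : Subgroup (EuclideanSpace ℝ (Fin 3) ≃ₗᵢ[ℝ] EuclideanSpace ℝ (Fin 3)))
    (c : ℝ) : Prop :=
  ∃ u : ℝ → EuclideanSpace ℝ (Fin 3) → EuclideanSpace ℝ (Fin 3),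
    IsAncientMildSolution 1 u ∧ (∀ t < 0, AEStronglyMeasurable (u t) volume) ∧
    IsDiscretelySelfSimilar c u ∧ (∃ C₀ : ℝ, HasTypeIDecay C₀ u) ∧
    (∀ g ∈ G, ∀ t x, u t (g x) = g (u t x)) ∧ ¬ (∀ t < 0, u t =ᵐ[volume] 0)

/-- A fibre over an admissible `(G, λ)` gives the crux (trivial direction). [this census] -/
theorem crux_of_fibre
    {G : Subgroup (EuclideanSpace ℝ (Fin 3) ≃ₗᵢ[ℝ] EuclideanSpace ℝ (Fin 3))} {c : ℝ}
    (hfin : Finite G)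
    (hdet : ∀ g ∈ G, LinearMap.det (g.toLinearEquiv :
        EuclideanSpace ℝ (Fin 3) →ₗ[ℝ] EuclideanSpace ℝ (Fin 3)) = 1)
    (hirr : ∀ V : Submodule ℝ (EuclideanSpace ℝ (Fin 3)),
        (∀ g ∈ G, ∀ v ∈ V, g v ∈ V) → V = ⊥ ∨ V = ⊤)
    (hc : 1 < c) (h : CruxFibre G c) :
    _root_.Summit.NavierStokesRegularity.NavierStokesRegularity.Theses.QuantisedSymmetry.PolyhedralDssProfileExists :=
  ⟨G, hfin, hdet, hirr, c, hc, h⟩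

/-! ## N — negative side: what the tree already excludes inside the polyhedral sector -/

/-- **Small-constant rung (sector-blind, DSS-blind, unconditional):** no witness of the crux has Type-I
constant `C₀ ≤ 8/25`; from the tree's `rdssClass_empty_of_typeI_le` (Gaussian-gap Liouville theorem)
with the trivial twist `R = 1`.  So the `∃ C₀` of the crux lives in `C₀ > 0.32`, where no Liouville
theorem — polyhedral or not — is known for coarse ratio `λ`. [tree composition] -/
theorem no_witness_of_typeI_le {M : ℝ} (hM : M ≤ 8 / 25) :
    ¬ ∃ G : Subgroup (EuclideanSpace ℝ (Fin 3) ≃ₗᵢ[ℝ] EuclideanSpace ℝ (Fin 3)),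
        ∃ c : ℝ, 1 < c ∧ ∃ u : ℝ → EuclideanSpace ℝ (Fin 3) → EuclideanSpace ℝ (Fin 3),
          IsAncientMildSolution 1 u ∧ (∀ t < 0, AEStronglyMeasurable (u t) volume) ∧
          IsDiscretelySelfSimilar c u ∧ HasTypeIDecay M u ∧
          (∀ g ∈ G, ∀ t x, u t (g x) = g (u t x)) ∧ ¬ (∀ t < 0, u t =ᵐ[volume] 0) := by
  rintro ⟨G, c, hc, u, hmild, hmeas, hdss, hdec, -, hne⟩
  exact _root_.Summit.NavierStokesRegularity.NavierStokesRegularity.Theorems.GaussianGap.rdssClass_empty_of_typeI_le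
    hM ⟨c, LinearIsometryEquiv.refl ℝ _, u, hc, hmild, hmeas, isRotatedDSS_refl_iff.mpr hdss, hdec, hne⟩

/-- **Fine-ratio rung (cited by name):** the catalogued barrier `NearOneDssTypeIExclusion` is a
theorem of the tree; its reformulation `threshold_le_ratio` says a nontrivial classical `λ`-DSS
Type-I profile with constant `C₀` has `λ ≥ λ₁(C₀) > 1` (Chae–Wolf 2017, Thm 1.3) — again
sector-blind.  Recorded here only to fix the name used in the census. [tree] -/
theorem fineRatio_rung_available :
    _root_.Literature.Barriers.NavierStokesRegularity.NearOneDssTypeIExclusion :=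
  _root_.Literature.Barriers.NavierStokesRegularity.NearOneDssTypeIExclusion_holds

end Summit.NavierStokesRegularity.NavierStokesRegularity.Cruxes.PolyhedralDssProfileExists.StrategistS14
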